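import Literature.Topology.Immersions.MicrobundleGermSlices
import Mathlib.Topology.MetricSpace.Pseudo.Lemmas
import Mathlib.Topology.Instances.Real.Lemmas
import Mathlib.Algebra.Order.Floor.Defs
import HarnessLib

/-!
# Microbundle germs in graph form, II: gluing trivialisations along the parameter

Topic `Literature/Topology/Immersions`.  Continuation of `MicrobundleGermSlices`: the two lemmas of
Milnor's proof of the microbundle homotopy theorem (*Microbundles, Part I*, Topology 3 Suppl. 1
(1964), §3 statement, §6 proof; restated in Kirby–Siebenmann, *Foundational Essays* (1977),
Essay IV §1, "the basic homotopy theorem [Mi₅, §6] for microbundles") which concern the parameter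
direction, for microbundles induced from a tangent microbundle `t_V` by a map `s : B × ℝ → V`
(graph form, see the module docstring of `MicrobundleGermSlices`; nothing is defined):

* `exists_trivialisation_glue` — **gluing**: if `s^* t_V` is trivial over (a neighbourhood of the
  graph over) `U × [a, m]` and over `U × [m, c]`, it is trivial over `U × [a, c]`.  Milnor's
  argument: the two trivialisations differ over `U × {m}` by a fibrewise homeomorphism germ `g`
  of `U × ℝⁿ` fixing the zero section; extend `g` constantly in `t` (`exists_spread`) and correct
  the second trivialisation by it, so that the two now agree over `t = m` and paste
  (`OpenPartialHomeomorph.piecewise` along `{t ≤ m}`, whose frontier lies in `{t = m}`).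
* `exists_trivialisation_nhds_prod_Icc` — **local triviality over `U × [0, 1]`**: every `b₀ ∈ B`
  has an open neighbourhood `U` such that `s^* t_V` is trivial over `U × [0, 1]`: finitely many
  chart-induced local trivialisations (`exists_local_trivialisation_comp`) cover `{b₀} × [0, 1]`;
  a Lebesgue number makes the `t`-intervals uniform and the gluing lemma is iterated.

## References

* J. Milnor, *Microbundles, Part I*, Topology 3 Suppl. 1 (1964) 53–80, §3 and §6. [Milnor1964]
* R. C. Kirby, L. C. Siebenmann, Ann. of Math. Stud. 88 (1977), Essay IV §1. [KirbySiebenmann1977]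
-/

open Set Function Filter Topology Metric

namespace Literature.Topology.Immersions

universe u v w

variable {B : Type u} [TopologicalSpace B] {V : Type v} [TopologicalSpace V]
  {E : Type w} [TopologicalSpace E]

/-! ### Gluing two trivialisations along `t = m` -/

/-- **Milnor 1964, §6 (first lemma of the proof of the Homotopy Theorem), graph form: gluing
trivialisations along the parameter.**  Let `s : B × ℝ → V` and let `Φ₁`, `Φ₂` be fibrewise
partial homeomorphisms `(B × ℝ) × V ⇀ (B × ℝ) × E` normalised along the graph of `s`, the first
over `U × [a, m]`, the second over `U × [m, c]` (`a ≤ m ≤ c`).  Then there is one normalised along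
the graph over `U × [a, c]`.  Construction: `g (u, x) = Φ₂ Φ₁⁻¹ ((u, m), x)` read in the fibre
(`exists_slice` at the constant section `m`), `G` its `t`-independent extension (`exists_spread`);
the partial homeomorphisms `Φ₁` and `G⁻¹ ∘ Φ₂` agree over `t = m` and are pasted along `{t ≤ m}`.
[cite: Milnor1964, §6, proof of the Homotopy Theorem of §3] [cite: KirbySiebenmann1977, Essay IV §1] -/
theorem exists_trivialisation_glue [Zero E] {s : B × ℝ → V} {U : Set B} {a m c : ℝ}
    (ham : a ≤ m) (hmc : m ≤ c)
    (Φ₁ Φ₂ : OpenPartialHomeomorph ((B × ℝ) × V) ((B × ℝ) × E))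
    (h₁ : ∀ p ∈ Φ₁.source, (Φ₁ p).1 = p.1) (h₂ : ∀ p ∈ Φ₂.source, (Φ₂ p).1 = p.1)
    (hg₁ : ∀ q ∈ U ×ˢ Icc a m, (q, s q) ∈ Φ₁.source ∧ Φ₁ (q, s q) = (q, 0))
    (hg₂ : ∀ q ∈ U ×ˢ Icc m c, (q, s q) ∈ Φ₂.source ∧ Φ₂ (q, s q) = (q, 0)) :
    ∃ Φ : OpenPartialHomeomorph ((B × ℝ) × V) ((B × ℝ) × E),
      (∀ p ∈ Φ.source, (Φ p).1 = p.1) ∧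
      (∀ q ∈ U ×ˢ Icc a c, (q, s q) ∈ Φ.source ∧ Φ (q, s q) = (q, 0)) := by
  classical
  -- the transition `D = Φ₂ ∘ Φ₁⁻¹`, fibrewise over `B × ℝ`
  set D := Φ₁.symm.trans Φ₂ with hD_def
  have h₁' : ∀ q ∈ Φ₁.symm.source, (Φ₁.symm q).1 = q.1 := fun q hq => fst_symm_eq Φ₁ h₁ hq
  have hD : ∀ p ∈ D.source, (D p).1 = p.1 := fst_trans_eq _ _ h₁' h₂
  have hD_symm : ∀ x, D.symm x = Φ₁ (Φ₂.symm x) := fun x => rfl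
  have hD_target : D.target = Φ₂.target ∩ Φ₂.symm ⁻¹' Φ₁.source := by
    rw [hD_def, OpenPartialHomeomorph.trans_target]; rfl
  -- its slice at `t = m` and the `t`-independent extension of the slice
  obtain ⟨g, hg, hgs, hgt, hga, hgs'⟩ := exists_slice D hD (continuous_const (y := m))
  obtain ⟨G, hG, hGs, hGt, hGa, hGs'⟩ := exists_spread g hg ℝ
  -- restrictions making the sources agree over `t = m`
  have hLopen : IsOpen {p : (B × ℝ) × V | p.1.2 ≠ m} :=
    isOpen_ne_fun (continuous_snd.comp continuous_fst) continuous_const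
  set Φ₁' := Φ₁.restrOpen ({p | p.1.2 ≠ m} ∪ Φ₂.source) (hLopen.union Φ₂.open_source)
    with hΦ₁'_def
  set Φ₂' := (Φ₂.restrOpen ({p | p.1.2 ≠ m} ∪ Φ₁.source) (hLopen.union Φ₁.open_source)).trans
    G.symm with hΦ₂'_def
  have hΦ₁' : ∀ p ∈ Φ₁'.source, (Φ₁' p).1 = p.1 := fst_restrOpen_eq Φ₁ h₁ _ _
  have hG' : ∀ q ∈ G.symm.source, (G.symm q).1 = q.1 := fun q hq => fst_symm_eq G hG hq
  have hΦ₂' : ∀ p ∈ Φ₂'.source, (Φ₂' p).1 = p.1 :=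
    fst_trans_eq _ _ (fst_restrOpen_eq Φ₂ h₂ _ _) hG'
  have hΦ₁'s : ∀ p, p ∈ Φ₁'.source ↔ p ∈ Φ₁.source ∧ (p.1.2 ≠ m ∨ p ∈ Φ₂.source) := by
    intro p; simp [hΦ₁'_def]
  have hΦ₂'s : ∀ p, p ∈ Φ₂'.source ↔
      (p ∈ Φ₂.source ∧ (p.1.2 ≠ m ∨ p ∈ Φ₁.source)) ∧ ((Φ₂ p).1.1, (Φ₂ p).2) ∈ g.target := by
    intro p
    simp only [hΦ₂'_def, OpenPartialHomeomorph.trans_source, OpenPartialHomeomorph.restrOpen_source,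
      OpenPartialHomeomorph.symm_source, hGt, mem_inter_iff, mem_union, mem_setOf_eq, mem_preimage,
      OpenPartialHomeomorph.coe_restrOpen]
  have hΦ₂'a : ∀ p, Φ₂' p = G.symm (Φ₂ p) := fun p => rfl
  -- over `t = m` the two agree
  have level : ∀ p, p.1.2 = m → p ∈ Φ₁.source → p ∈ Φ₂.source →
      p ∈ Φ₂'.source ∧ Φ₂' p = Φ₁ p := by
    intro p hpm hp1 hp2
    have hfst : (Φ₂ p).1 = p.1 := h₂ p hp2
    have hpt : ((Φ₂ p).1.1, m) = (Φ₂ p).1 := by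
      rw [hfst]; exact Prod.ext rfl hpm.symm
    have hmemD : ((Φ₂ p).1, (Φ₂ p).2) ∈ D.target := by
      rw [Prod.mk.eta, hD_target]
      exact ⟨Φ₂.map_source hp2, by rw [mem_preimage, Φ₂.left_inv hp2]; exact hp1⟩
    refine ⟨(hΦ₂'s p).2 ⟨⟨hp2, Or.inr hp1⟩, ?_⟩, ?_⟩
    · rw [hgt, mem_setOf_eq, hpt]; exact hmemD
    · rw [hΦ₂'a, hGs', hgs', hpt, Prod.mk.eta, hD_symm, Φ₂.left_inv hp2, hfst]
      exact (eq_of_fibrewise Φ₁ h₁ hp1).symm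
  have level' : ∀ p, p.1.2 = m → p ∈ Φ₂'.source → p ∈ Φ₁.source ∧ p ∈ Φ₂.source := by
    intro p hpm hp
    obtain ⟨⟨hp2, h⟩, -⟩ := (hΦ₂'s p).1 hp
    exact ⟨h.resolve_left (fun h' => h' hpm), hp2⟩
  -- the pasting
  set S : Set ((B × ℝ) × V) := {p | p.1.2 ≤ m} with hS_def
  set S' : Set ((B × ℝ) × E) := {q | q.1.2 ≤ m} with hS'_def
  have hfrS : frontier S ⊆ {p | p.1.2 = m} :=
    frontier_le_subset_eq (continuous_snd.comp continuous_fst) continuous_const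
  have H : Φ₁'.IsImage S S' := by
    intro p hp; change (Φ₁' p).1.2 ≤ m ↔ p.1.2 ≤ m; rw [hΦ₁' p hp]
  have H' : Φ₂'.IsImage S S' := by
    intro p hp; change (Φ₂' p).1.2 ≤ m ↔ p.1.2 ≤ m; rw [hΦ₂' p hp]
  have Hs : Φ₁'.source ∩ frontier S = Φ₂'.source ∩ frontier S := by
    ext p
    constructor
    · rintro ⟨hp, hfr⟩
      have hpm : p.1.2 = m := hfrS hfr
      obtain ⟨hp1, h⟩ := (hΦ₁'s p).1 hp
      exact ⟨(level p hpm hp1 (h.resolve_left fun h' => h' hpm)).1, hfr⟩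
    · rintro ⟨hp, hfr⟩
      have hpm : p.1.2 = m := hfrS hfr
      obtain ⟨hp1, hp2⟩ := level' p hpm hp
      exact ⟨(hΦ₁'s p).2 ⟨hp1, Or.inr hp2⟩, hfr⟩
  have Heq : EqOn Φ₁' Φ₂' (Φ₁'.source ∩ frontier S) := by
    rintro p ⟨hp, hfr⟩
    have hpm : p.1.2 = m := hfrS hfr
    obtain ⟨hp1, h⟩ := (hΦ₁'s p).1 hp
    exact ((level p hpm hp1 (h.resolve_left fun h' => h' hpm)).2).symm
  have hsrc : (Φ₁'.piecewise Φ₂' S S' H H' Hs Heq).source = S.ite Φ₁'.source Φ₂'.source := rfl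
  refine ⟨Φ₁'.piecewise Φ₂' S S' H H' Hs Heq, ?_, ?_⟩
  · intro p hp
    rw [OpenPartialHomeomorph.piecewise_apply]
    rw [hsrc] at hp
    by_cases hpS : p ∈ S
    · rw [Set.piecewise_eq_of_mem _ _ _ hpS]
      have : p ∈ Φ₁'.source := by
        rcases hp with ⟨h, -⟩ | ⟨-, h⟩
        · exact h
        · exact absurd hpS h
      exact hΦ₁' p this
    · rw [Set.piecewise_eq_of_notMem _ _ _ hpS]
      have : p ∈ Φ₂'.source := by
        rcases hp with ⟨-, h⟩ | ⟨h, -⟩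
        · exact absurd h hpS
        · exact h
      exact hΦ₂' p this
  · rintro ⟨u, t⟩ ⟨hu, hta, htc⟩
    by_cases htm : t ≤ m
    · -- left piece
      have hpS : ((u, t), s (u, t)) ∈ S := htm
      obtain ⟨hp1, hv1⟩ := hg₁ (u, t) ⟨hu, hta, htm⟩
      have hp1' : ((u, t), s (u, t)) ∈ Φ₁'.source := by
        refine (hΦ₁'s _).2 ⟨hp1, ?_⟩
        by_cases h : t = m
        · subst h; exact Or.inr (hg₂ (u, t) ⟨hu, le_rfl, hmc⟩).1
        · exact Or.inl h
      refine ⟨?_, ?_⟩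
      · rw [hsrc]; exact Or.inl ⟨hp1', hpS⟩
      · rw [OpenPartialHomeomorph.piecewise_apply, Set.piecewise_eq_of_mem _ _ _ hpS]
        exact hv1
    · -- right piece
      have hpS : ((u, t), s (u, t)) ∉ S := htm
      have hmt : m ≤ t := le_of_not_ge htm
      obtain ⟨hp2, hv2⟩ := hg₂ (u, t) ⟨hu, hmt, htc⟩
      -- the point `((u, m), s (u, m))` controls `g` at `(u, 0)`
      obtain ⟨hq1, hw1⟩ := hg₁ (u, m) ⟨hu, ham, le_rfl⟩
      obtain ⟨hq2, hw2⟩ := hg₂ (u, m) ⟨hu, le_rfl, hmc⟩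
      have hm0 : (((u, m), (0 : E)) : (B × ℝ) × E) ∈ D.target := by
        rw [hD_target]
        refine ⟨by rw [← hw2]; exact Φ₂.map_source hq2, ?_⟩
        rw [mem_preimage, ← hw2, Φ₂.left_inv hq2]; exact hq1
      have hg0 : ((u, (0 : E)) : B × E) ∈ g.target := by rw [hgt]; exact hm0
      have hg0v : g.symm (u, 0) = (u, 0) := by
        rw [hgs', hD_symm]
        change (u, (Φ₁ (Φ₂.symm ((u, m), 0))).2) = (u, 0)
        rw [← hw2, Φ₂.left_inv hq2, hw1]
      have hp2' : ((u, t), s (u, t)) ∈ Φ₂'.source := by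
        refine (hΦ₂'s _).2 ⟨⟨hp2, Or.inl (fun h => htm (le_of_eq h))⟩, ?_⟩
        rw [hv2]; exact hg0
      refine ⟨?_, ?_⟩
      · rw [hsrc]; exact Or.inr ⟨hp2', hpS⟩
      · rw [OpenPartialHomeomorph.piecewise_apply, Set.piecewise_eq_of_notMem _ _ _ hpS, hΦ₂'a,
          hv2, hGs']
        change ((u, t), (g.symm (u, 0)).2) = ((u, t), 0)
        rw [hg0v]

/-! ### Local triviality over `U × [0, 1]` -/

/-- Monotonicity of "normalised along the graph over `A`" in `A`. [folklore] -/
theorem trivialises_mono [Zero E] {s : B × ℝ → V} {A A' : Set (B × ℝ)} (hA : A' ⊆ A)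
    {Φ : OpenPartialHomeomorph ((B × ℝ) × V) ((B × ℝ) × E)}
    (h : ∀ q ∈ A, (q, s q) ∈ Φ.source ∧ Φ (q, s q) = (q, 0)) :
    ∀ q ∈ A', (q, s q) ∈ Φ.source ∧ Φ (q, s q) = (q, 0) := fun q hq => h q (hA hq)

section LocalProduct

variable [AddGroup E] [IsTopologicalAddGroup E] [ChartedSpace E V]

/-- A uniform form of local triviality along `{b₀} × [0, 1]`: there are an open `U ∋ b₀` and
`ε > 0` such that for every `t ∈ [0, 1]` the induced microbundle is trivial over
`U × [t - ε, t + ε]` (finitely many chart-induced trivialisations cover the compact segment; a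
Lebesgue number makes the intervals uniform). [folklore] -/
theorem exists_uniform_local_trivialisation {s : B × ℝ → V} (hs : Continuous s) (b₀ : B) :
    ∃ U : Set B, IsOpen U ∧ b₀ ∈ U ∧ ∃ ε : ℝ, 0 < ε ∧ ∀ t ∈ Icc (0 : ℝ) 1,
      ∃ Φ : OpenPartialHomeomorph ((B × ℝ) × V) ((B × ℝ) × E),
        (∀ p ∈ Φ.source, (Φ p).1 = p.1) ∧
        (∀ q ∈ U ×ˢ Icc (t - ε) (t + ε), (q, s q) ∈ Φ.source ∧ Φ (q, s q) = (q, 0)) := by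
  -- local boxes around each `(b₀, t)`
  have box : ∀ t : ℝ, ∃ Ut : Set B, IsOpen Ut ∧ b₀ ∈ Ut ∧ ∃ Wt : Set ℝ, IsOpen Wt ∧ t ∈ Wt ∧
      ∃ Φ : OpenPartialHomeomorph ((B × ℝ) × V) ((B × ℝ) × E),
        (∀ p ∈ Φ.source, (Φ p).1 = p.1) ∧
        (∀ q ∈ Ut ×ˢ Wt, (q, s q) ∈ Φ.source ∧ Φ (q, s q) = (q, 0)) := by
    intro t
    obtain ⟨N, hN, hN₀, Φ, hΦ, -, -, hgr⟩ := exists_local_trivialisation_comp (E := E) hs (b₀, t)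
    obtain ⟨Ut, Wt, hUt, hb, hWt, ht, hsub⟩ := mem_nhds_prod_iff'.1 (hN.mem_nhds hN₀)
    exact ⟨Ut, hUt, hb, Wt, hWt, ht, Φ, hΦ, fun q hq => hgr q (hsub hq)⟩
  choose Ut hUt hbt Wt hWt htt Φt hΦt hgrt using box
  -- finitely many boxes cover `{b₀} × [0, 1]`
  obtain ⟨F, hF⟩ := isCompact_Icc.elim_finite_subcover (fun t : ℝ => Wt t) (fun t => hWt t)
    (fun t ht => mem_iUnion.2 ⟨t, htt t⟩)
  set U : Set B := ⋂ t ∈ F, Ut t with hU_def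
  have hU : IsOpen U := isOpen_biInter_finset fun t _ => hUt t
  have hbU : b₀ ∈ U := mem_iInter₂.2 fun t _ => hbt t
  -- a Lebesgue number for the finite cover
  obtain ⟨δ, hδ, hδcov⟩ := lebesgue_number_lemma_of_metric (ι := {t // t ∈ F})
    (c := fun i => Wt i.1) isCompact_Icc (fun i => hWt i.1) (by
      intro x hx
      obtain ⟨t, ht⟩ := mem_iUnion.1 (hF hx)
      obtain ⟨htF, hxt⟩ := mem_iUnion.1 ht
      exact mem_iUnion.2 ⟨⟨t, htF⟩, hxt⟩)
  refine ⟨U, hU, hbU, δ / 2, by positivity, fun t ht => ?_⟩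
  obtain ⟨⟨i, hiF⟩, hball⟩ := hδcov t ht
  refine ⟨Φt i, hΦt i, fun q hq => hgrt i q ⟨?_, hball ?_⟩⟩
  · exact mem_iInter₂.1 hq.1 i hiF
  · rw [mem_ball, Real.dist_eq, abs_lt]
    constructor <;> linarith [hq.2.1, hq.2.2]

/-- **Milnor 1964, §6 (second lemma of the proof of the Homotopy Theorem), graph form: local
triviality over `U × [0, 1]`.**  For `s : B × ℝ → V` continuous into a manifold charted on the
topological group `E` and `b₀ ∈ B`, there are an open `U ∋ b₀` and a fibrewise partial
homeomorphism `(B × ℝ) × V ⇀ (B × ℝ) × E` normalised along the graph of `s` over `U × [0, 1]`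
(iterate `exists_trivialisation_glue` over the uniform intervals of
`exists_uniform_local_trivialisation`).
[cite: Milnor1964, §6, proof of the Homotopy Theorem of §3] [cite: KirbySiebenmann1977, Essay IV §1] -/
theorem exists_trivialisation_nhds_prod_Icc {s : B × ℝ → V} (hs : Continuous s) (b₀ : B) :
    ∃ U : Set B, IsOpen U ∧ b₀ ∈ U ∧ ∃ Φ : OpenPartialHomeomorph ((B × ℝ) × V) ((B × ℝ) × E),
      (∀ p ∈ Φ.source, (Φ p).1 = p.1) ∧
      (∀ q ∈ U ×ˢ Icc (0 : ℝ) 1, (q, s q) ∈ Φ.source ∧ Φ (q, s q) = (q, 0)) := by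
  obtain ⟨U, hU, hbU, ε, hε, hloc⟩ := exists_uniform_local_trivialisation (E := E) hs b₀
  refine ⟨U, hU, hbU, ?_⟩
  -- induction over the levels `k ε`
  have step : ∀ k : ℕ, (k : ℝ) * ε ≤ 1 + ε →
      ∃ Φ : OpenPartialHomeomorph ((B × ℝ) × V) ((B × ℝ) × E),
        (∀ p ∈ Φ.source, (Φ p).1 = p.1) ∧
        (∀ q ∈ U ×ˢ Icc (0 : ℝ) (k * ε), (q, s q) ∈ Φ.source ∧ Φ (q, s q) = (q, 0)) := by
    intro k
    induction k with
    | zero =>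
      intro _
      obtain ⟨Φ, hΦ, hgr⟩ := hloc 0 ⟨le_rfl, zero_le_one⟩
      refine ⟨Φ, hΦ, trivialises_mono ?_ hgr⟩
      rintro ⟨u, t⟩ ⟨hu, ht0, ht1⟩
      refine ⟨hu, ?_, ?_⟩ <;> push_cast at ht1 ⊢ <;> linarith
    | succ k ih =>
      intro hk
      push_cast at hk
      have hk1 : (k : ℝ) * ε ≤ 1 := by nlinarith
      obtain ⟨Φ₁, hΦ₁, hgr₁⟩ := ih (by linarith)
      obtain ⟨Φ₂, hΦ₂, hgr₂⟩ := hloc (k * ε) ⟨by positivity, hk1⟩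
      obtain ⟨Φ, hΦ, hgr⟩ := exists_trivialisation_glue (a := 0) (m := k * ε) (c := k * ε + ε)
        (by positivity) (by linarith) Φ₁ Φ₂ hΦ₁ hΦ₂ hgr₁
        (trivialises_mono (by
          rintro ⟨u, t⟩ ⟨hu, ht0, ht1⟩
          exact ⟨hu, by linarith, ht1⟩) hgr₂)
      refine ⟨Φ, hΦ, trivialises_mono ?_ hgr⟩
      rintro ⟨u, t⟩ ⟨hu, ht0, ht1⟩
      refine ⟨hu, ht0, ?_⟩
      push_cast at ht1
      linarith
  -- the level `⌈1/ε⌉ ε ≥ 1`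
  obtain ⟨Φ, hΦ, hgr⟩ := step ⌈1 / ε⌉₊ (by
    have h1 : ((⌈1 / ε⌉₊ : ℕ) : ℝ) < 1 / ε + 1 := Nat.ceil_lt_add_one (by positivity)
    calc ((⌈1 / ε⌉₊ : ℕ) : ℝ) * ε ≤ (1 / ε + 1) * ε := by
          exact mul_le_mul_of_nonneg_right h1.le hε.le
      _ = 1 + ε := by field_simp)
  refine ⟨Φ, hΦ, trivialises_mono ?_ hgr⟩
  rintro ⟨u, t⟩ ⟨hu, ht0, ht1⟩
  refine ⟨hu, ht0, le_trans ht1 ?_⟩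
  calc (1 : ℝ) = (1 / ε) * ε := by field_simp
    _ ≤ (⌈1 / ε⌉₊ : ℕ) * ε := mul_le_mul_of_nonneg_right (Nat.le_ceil _) hε.le

end LocalProduct

end Literature.Topology.Immersions
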